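import Literature.AlgebraicGeometry.Motives.FunctionalEquationForProjectiveSpaceOverBase
import Literature.AlgebraicGeometry.Motives.TateTypeZetaFunctionalEquation
import Literature.AlgebraicGeometry.Motives.GrassmannianOfLinesOverBase
import HarnessLib

/-!
# The functional equation for a product of rescaled zeta functions with Poincaré-symmetric weights:
# if `Z(1/(q^d T)) = ε q^{dχ/2} T^χ Z(T)` and `aᵢ + a_{σ(i)} = m` for an involution `σ` of the index set `s`,
# then `Z' = ∏_{i ∈ s} Z(q^{aᵢ}T)` satisfies `Z'(1/(q^{d+m}T)) = ε^{#s} q^{(d+m)χ'/2} T^{χ'} Z'(T)`, `χ' = #s·χ`;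
# the functional equation of `Z(X × G(1, ℙⁿ⁺¹), T)`

Topic `Literature/AlgebraicGeometry/Motives`; THEOREMS ONLY (no definition, no instance, no named fact;
D-0026).  `Motives/FunctionalEquationForProjectiveSpaceOverBase` transferred the functional equation of the
tree's `HasFunctionalEquation q d Z χ` (`Motives/ZetaFunction`: `Z = A/B`, `T^{χ⁻} Ã B = ε q^{dχ/2} T^{χ⁺} A B̃` in
`ℝ[T]`, `Ã = T^N A(1/(q^d T))` the tree's `reflectScale`) from `Z(T)` to `∏_{i=0}^{n} Z(qⁱT)` — the weights
`0, 1, …, n` of the cells of `ℙⁿ`.  The argument only uses that the weights are permuted by an involution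
`i ↦ n − i` with constant sum; this file runs it for an ARBITRARY finite family of weights `(aᵢ)_{i ∈ s}` with an
involution `σ` of `s` such that `aᵢ + a_{σ(i)} = m` (`HasFunctionalEquation.prod_rescale_of_symm`), and applies it
to the Grassmannian of lines over a base: `Z(X × G(1, ℙⁿ⁺¹), T) = ∏_{n ≥ a ≥ b ≥ 0} Z(X, q^{a+b}T)`
(`Motives/GrassmannianOfLinesOverBase`), whose weights `a + b` are permuted by the complementary Young diagram
`(a, b) ↦ (n − b, n − a)` with `(a + b) + ((n−b) + (n−a)) = 2n` (`Motives/TateTypeZetaFunctionalEquation`,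
`schubertPairs_compl`): **if `Z(X, T)` satisfies the functional equation in dimension `d` with Euler
characteristic `χ`, then `Z(X × G(1, ℙⁿ⁺¹), T)` satisfies it in dimension `d + 2n` with `χ' = binom(n+2, 2)·χ`**
and sign `ε^{binom(n+2,2)}` — Hartshorne's `E(X × G) = E(X)·E(G)`.

## Sources, read on the page

R. Hartshorne, *Algebraic Geometry* [Hartshorne1977], App. C §1 (1.2) (the functional equation
`Z(1/(qⁿt)) = ± q^{nE/2} t^E Z(t)`, `E` the self-intersection of the diagonal) and Th. 4.4.
B. Kahn, *Zeta and L-functions of varieties and motives* [Kahn2020], Prop. 2.3 (4) («`ζ(X × 𝐀¹, s) = ζ(X, s−1)`»),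
(5) («`ζ(𝐏ⁿ_X, s) = ∏ ζ(X, s − i)`»), §3.3 p. 47 («the case of Grassmannian varieties now seems easy, insofar as
they are cellular», held p0047) and (3.6.5) (the functional equation from Poincaré duality).
A. Weil, *Numbers of solutions of equations in finite fields* [Weil1949], p. 507 (the functional equation
«`Z(1/(qⁿU)) = ± q^{nχ/2} U^χ Z(U)` with `χ` equal to the Euler–Poincaré characteristic»), p. 508 (Grassmannians;
held p0011–p0012).
G. E. Andrews, *The Theory of Partitions* [Andrews1976Partitions], §3.5 Thm. 3.10 (3.5.4) (reciprocity of the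
Gaussian polynomial: the symmetry of the weights).

## What is here

* §1 (pure algebra, any `Z ∈ ℚ⟦T⟧`) `reflectScale_prod_comp_C_pow_mul_X_of_symm` (`T^{#s·N} A'(1/(q^{d+m}T)) =
  q^{−N Σ aᵢ} ∏ᵢ Ã(q^{aᵢ}T)` for `A' = ∏ᵢ A(q^{aᵢ}T)`) and **`HasFunctionalEquation.prod_rescale_of_symm`**:
  `HasFunctionalEquation q d Z χ`, `σ` an involution of `s` with `aᵢ + a_{σ i} = m` ⟹
  `HasFunctionalEquation q (d + m) (∏_{i ∈ s} Z(q^{aᵢ}T)) (#s · χ)` (sign `ε^{#s}`; the exponent bookkeeping is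
  `2 Σᵢ aᵢ = m · #s`, `two_mul_sum_eq_of_symm`).  The tree's `prod_rescale` is the special case `s = {0, …, n}`,
  `aᵢ = i`, `σ i = n − i`, `m = n`.
* §2 **`hasFunctionalEquation_tensor_grassmannianOfLines`**: FE for `Z(X, T)` in dimension `d` with `χ` ⟹ FE for
  `Z(X × G(1, ℙⁿ⁺¹), T)` in dimension `d + 2n` with `binom(n+2, 2)·χ`; `…_grassmannianOfLines_tensor` (`G × X`);
  the examples `ℙᵐ × G(1, ℙⁿ⁺¹)` and `G(1, ℙᵐ⁺¹) × G(1, ℙⁿ⁺¹)` (from the tree's `hasFunctionalEquation_projectiveSpace`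
  and `hasFunctionalEquation_grassmannianOfLines`).

## References

* [Hartshorne1977] R. Hartshorne, *Algebraic Geometry*, GTM 52 (1977), App. C §1 (1.2), Th. 4.4.
* [Kahn2020] B. Kahn, *Zeta and L-functions of varieties and motives*, LMS LNS 462 (2020), Prop. 2.3 (4), (5);
  §3.3 p. 47; (3.6.5).
* [Weil1949] A. Weil, *Numbers of solutions of equations in finite fields*, Bull. AMS 55 (1949), pp. 507–508.
* [Andrews1976Partitions] G. E. Andrews, *The Theory of Partitions* (1976), §3.5 Thm. 3.10 (3.5.4).

## Provenance

Lane `lit-hodgefound` (summit `HodgeConjecture`, Track 2 foundations library, Layer B: motives / zeta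
functions), seat `lit-hodgefound-p29` (literature-prover, generation 51, row g51-#10).
-/

universe u

open Polynomial CategoryTheory MonoidalCategory

noncomputable section

namespace Literature.AlgebraicGeometry.Motives

/-! ### §1 The functional equation passes from `Z(T)` to `∏_{i ∈ s} Z(q^{aᵢ}T)` for symmetric weights -/

section Plumbing

variable {K : Type*} [Field K]

/-- `(p ∘ (aT)) ∘ (bT) = p ∘ (abT)` (private plumbing). [folklore] -/
private theorem comp_C_mul_X_comp_C_mul_X' (p : K[X]) (a b : K) :
    (p.comp (C a * X)).comp (C b * X) = p.comp (C (a * b) * X) := by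
  rw [comp_assoc, mul_comp, C_comp, X_comp, ← mul_assoc, ← C_mul]

/-- `deg (p ∘ (aT)) ≤ deg p` (private plumbing). [folklore] -/
private theorem natDegree_comp_C_mul_X_le' (p : K[X]) (a : K) : (p.comp (C a * X)).natDegree ≤ p.natDegree :=
  natDegree_comp_le.trans (by
    calc p.natDegree * (C a * X).natDegree ≤ p.natDegree * 1 :=
          Nat.mul_le_mul_left _ ((natDegree_C_mul_le a X).trans natDegree_X_le)
      _ = p.natDegree := mul_one _)

/-- `(rescale a) B = B ∘ (aT)` for a polynomial `B` as a power series (private plumbing). [folklore] -/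
private theorem rescale_coe_eq_coe_comp' (a : K) (B : K[X]) :
    PowerSeries.rescale a (B : PowerSeries K) = ((B.comp (C a * X) : K[X]) : PowerSeries K) := by
  induction B using Polynomial.induction_on' with
  | add p q hp hq => rw [Polynomial.coe_add, map_add, hp, hq, add_comp, Polynomial.coe_add]
  | monomial j r =>
    have hC : PowerSeries.rescale a (PowerSeries.C r) = PowerSeries.C r := by
      ext i
      rw [PowerSeries.coeff_rescale, PowerSeries.coeff_C]
      split_ifs with hi
      · rw [hi, pow_zero, one_mul]
      · rw [mul_zero]
    rw [monomial_comp, ← C_mul_X_pow_eq_monomial, mul_pow, ← map_pow, ← mul_assoc, ← map_mul,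
      Polynomial.coe_mul, Polynomial.coe_C, Polynomial.coe_pow, Polynomial.coe_X, Polynomial.coe_mul,
      Polynomial.coe_C, Polynomial.coe_pow, Polynomial.coe_X, map_mul, map_pow, hC, PowerSeries.rescale_X,
      mul_pow, ← map_pow, ← mul_assoc, ← map_mul]

variable {ι : Type*} {s : Finset ι} {a : ι → ℕ}

/-- `deg ∏_{i ∈ s} A(q^{aᵢ}T) ≤ #s · N` when `deg A ≤ N` (private plumbing). [folklore] -/
private theorem natDegree_prod_comp_le' (A : K[X]) {N : ℕ} (hA : A.natDegree ≤ N) (q : K) :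
    (∏ i ∈ s, A.comp (C (q ^ a i) * X)).natDegree ≤ s.card * N := by
  refine (natDegree_prod_le _ _).trans ?_
  calc ∑ i ∈ s, (A.comp (C (q ^ a i) * X)).natDegree ≤ ∑ _i ∈ s, N :=
        Finset.sum_le_sum fun i _ => (natDegree_comp_C_mul_X_le' _ _).trans hA
    _ = s.card * N := by rw [Finset.sum_const, smul_eq_mul]

variable {σ : ι → ι} {m : ℕ}

/-- **`T^{#s·N} A'(1/(q^{d+m}T))` for `A' = ∏_{i ∈ s} A(q^{aᵢ}T)` with symmetric weights**: if `σ` is an involution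
of `s` with `aᵢ + a_{σ(i)} = m`, then with `Ã = T^N A(1/(q^d T))`,
`reflectScale (#s·N) (q^{d+m})⁻¹ A' = C((q^{N·Σᵢ aᵢ})⁻¹) · ∏_{i ∈ s} Ã(q^{aᵢ}T)` — each factor
`T^N A(q^{aᵢ}/(q^{d+m}T)) = q^{−a_{σ i}N} Ã(q^{a_{σ i}}T)`, reindexed along `σ`. [cite: Hartshorne1977, App. C §1 (1.2)]
[cite: Kahn2020, (3.6.5)] -/
theorem reflectScale_prod_comp_C_pow_mul_X_of_symm [Infinite K] {q : K} (hq : q ≠ 0) {A : K[X]} {N : ℕ}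
    (hA : A.natDegree ≤ N) (d : ℕ) (hσs : ∀ i ∈ s, σ i ∈ s) (hσσ : ∀ i ∈ s, σ (σ i) = i)
    (ha : ∀ i ∈ s, a i + a (σ i) = m) :
    reflectScale (s.card * N) ((q ^ (d + m))⁻¹) (∏ i ∈ s, A.comp (C (q ^ a i) * X)) =
      C ((q ^ (N * ∑ i ∈ s, a i))⁻¹) * ∏ i ∈ s, (reflectScale N ((q ^ d)⁻¹) A).comp (C (q ^ a i) * X) := by
  rw [reflectScale_prod_of_natDegree_le s (fun i => A.comp (C (q ^ a i) * X)) N ((q ^ (d + m))⁻¹)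
    fun i _ => (natDegree_comp_C_mul_X_le' _ _).trans hA]
  -- each factor
  have hfac : ∀ i ∈ s, reflectScale N ((q ^ (d + m))⁻¹) (A.comp (C (q ^ a i) * X)) =
      C ((q ^ a (σ i))⁻¹ ^ N) * (reflectScale N ((q ^ d)⁻¹) A).comp (C (q ^ a (σ i)) * X) := by
    intro i hi
    have hc : q ^ a i * (q ^ (d + m))⁻¹ = (q ^ d)⁻¹ * (q ^ a (σ i))⁻¹ := by
      have h1 : q ^ (d + m) = q ^ a i * (q ^ d * q ^ a (σ i)) := by
        rw [← pow_add, ← pow_add]; congr 1; have := ha i hi; omega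
      rw [h1, mul_inv, mul_inv, ← mul_assoc, ← mul_assoc, mul_inv_cancel₀ (pow_ne_zero _ hq), one_mul]
    rw [reflectScale, comp_C_mul_X_comp_C_mul_X', hc, ← reflectScale, reflectScale_mul_inv_eq hA _ (pow_ne_zero _ hq)]
  -- reindex both products along the involution `σ`
  have hre1 : ∏ i ∈ s, (reflectScale N ((q ^ d)⁻¹) A).comp (C (q ^ a (σ i)) * X) =
      ∏ i ∈ s, (reflectScale N ((q ^ d)⁻¹) A).comp (C (q ^ a i) * X) :=
    Finset.prod_nbij' σ σ hσs hσs hσσ hσσ fun _ _ => rfl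
  have hre2 : ∏ i ∈ s, C ((q ^ a (σ i))⁻¹ ^ N) = ∏ i ∈ s, C ((q ^ a i)⁻¹ ^ N) :=
    Finset.prod_nbij' σ σ hσs hσs hσσ hσσ fun _ _ => rfl
  rw [Finset.prod_congr rfl hfac, Finset.prod_mul_distrib, hre1, hre2, ← map_prod C]
  congr 2
  rw [Finset.prod_pow, Finset.prod_inv_distrib, Finset.prod_pow_eq_pow_sum, inv_pow, ← pow_mul, mul_comm]

/-- `((c : ℤ) χ)⁺ = c χ⁺` for `c : ℕ` (private arithmetic). [folklore] -/
private theorem toNat_natCast_mul' (c : ℕ) (χ : ℤ) : ((c : ℤ) * χ).toNat = c * χ.toNat := by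
  by_cases hχ : 0 ≤ χ
  · have h1 : (((c : ℤ) * χ).toNat : ℤ) = ((c * χ.toNat : ℕ) : ℤ) := by
      rw [Int.toNat_of_nonneg (mul_nonneg (Int.natCast_nonneg c) hχ), Nat.cast_mul, Int.toNat_of_nonneg hχ]
    exact_mod_cast h1
  · have hχ' : χ < 0 := lt_of_not_ge hχ
    rw [Int.toNat_eq_zero.mpr (by nlinarith [Int.natCast_nonneg c]), Int.toNat_eq_zero.mpr hχ'.le, mul_zero]

/-- `((c : ℤ) χ)⁻ = c χ⁻` for `c : ℕ` (private arithmetic). [folklore] -/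
private theorem toNat_neg_natCast_mul' (c : ℕ) (χ : ℤ) : (-((c : ℤ) * χ)).toNat = c * (-χ).toNat := by
  rw [← toNat_natCast_mul', mul_neg]

end Plumbing

section Transfer

open PowerSeries (rescale)

variable {ι : Type*} {s : Finset ι} {σ : ι → ι} {a : ι → ℕ} {m : ℕ}

/-- **The functional equation passes to `∏_{i ∈ s} Z(q^{aᵢ}T)` when the weights are Poincaré-symmetric.**  If
`Z ∈ ℚ⟦T⟧` satisfies `HasFunctionalEquation q d Z χ` — `Z(1/(q^d T)) = ε q^{dχ/2} T^χ Z(T)` in the cross-multiplied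
normal form `Z = A/B`, `T^{χ⁻} Ã B = ε q^{dχ/2} T^{χ⁺} A B̃` — and `σ` is an involution of the finite index set `s`
with `aᵢ + a_{σ(i)} = m` for all `i ∈ s`, then `Z' = ∏_{i ∈ s} Z(q^{aᵢ}T)` satisfies
`HasFunctionalEquation q (d + m) Z' (#s · χ)` with the sign `ε^{#s}`:
`Z'(1/(q^{d+m}T)) = ∏ᵢ Z(1/(q^d · q^{a_{σ i}}T)) = ∏ⱼ ε q^{dχ/2} (q^{aⱼ}T)^χ Z(q^{aⱼ}T) = ε^{#s} q^{#s·dχ/2 + χ Σ aⱼ} T^{#s χ}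
Z'(T)`, and `#s·dχ/2 + χ Σⱼ aⱼ = (d + m)·#s·χ/2` because `2 Σⱼ aⱼ = m·#s`.  This is the functional equation of
the zeta function of a cellular fibration over `X` with Poincaré-symmetric cells (projective bundles,
Grassmann bundles) from that of `X` (Kahn Prop. 2.3 (4)–(5), (3.6.5); Hartshorne App. C (1.2), Th. 4.4:
`E(X × F) = E(X)·E(F)`). [cite: Hartshorne1977, App. C §1 (1.2) and Th. 4.4] [cite: Kahn2020, Prop. 2.3 (4), (5); (3.6.5)]
[cite: Weil1949, p. 507] -/
theorem HasFunctionalEquation.prod_rescale_of_symm {q d : ℕ} (hq : 0 < q) {Z : PowerSeries ℚ} {χ : ℤ}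
    (h : HasFunctionalEquation q d Z χ) (hσs : ∀ i ∈ s, σ i ∈ s) (hσσ : ∀ i ∈ s, σ (σ i) = i)
    (ha : ∀ i ∈ s, a i + a (σ i) = m) :
    HasFunctionalEquation q (d + m) (∏ i ∈ s, rescale ((q : ℚ) ^ a i) Z) (((s.card : ℕ) : ℤ) * χ) := by
  obtain ⟨A, B, N, ε, hB0, hZ, hA, hB, hEq⟩ := h
  have hq0 : (q : ℚ) ≠ 0 := by exact_mod_cast hq.ne'
  have hqR : (0 : ℝ) < q := by exact_mod_cast hq
  have hqR0 : (q : ℝ) ≠ 0 := hqR.ne'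
  refine ⟨∏ i ∈ s, A.comp (C ((q : ℚ) ^ a i) * X), ∏ i ∈ s, B.comp (C ((q : ℚ) ^ a i) * X), s.card * N,
    ε ^ s.card, ?_, ?_, natDegree_prod_comp_le' A hA _, natDegree_prod_comp_le' B hB _, ?_⟩
  · -- `B'(0) = B(0)^{#s} ≠ 0`
    rw [coeff_zero_eq_eval_zero, eval_prod]
    exact Finset.prod_ne_zero_iff.mpr fun i _ => by
      rw [eval_comp, eval_mul, eval_C, eval_X, mul_zero, ← coeff_zero_eq_eval_zero]
      exact hB0
  · -- `Z' · B' = A'` factor by factor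
    simp only [← Polynomial.coeToPowerSeries.ringHom_apply, map_prod, ← Finset.prod_mul_distrib]
    refine Finset.prod_congr rfl fun i _ => ?_
    rw [Polynomial.coeToPowerSeries.ringHom_apply, Polynomial.coeToPowerSeries.ringHom_apply,
      ← rescale_coe_eq_coe_comp', ← rescale_coe_eq_coe_comp', ← map_mul, hZ]
  · -- the cross-multiplied functional equation
    rw [toNat_natCast_mul', toNat_neg_natCast_mul', reflectScale_prod_comp_C_pow_mul_X_of_symm hq0 hA d hσs hσσ ha,
      reflectScale_prod_comp_C_pow_mul_X_of_symm hq0 hB d hσs hσσ ha]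
    set φ := algebraMap ℚ ℝ with hφ
    set S : ℕ := ∑ i ∈ s, a i with hS
    have hmapc : ∀ (P : ℚ[X]) (j : ℕ),
        (P.comp (C ((q : ℚ) ^ j) * X)).map φ = (P.map φ).comp (C (q : ℝ) ^ j * X) := fun P j => by
      rw [Polynomial.map_comp, Polynomial.map_mul, Polynomial.map_C, Polynomial.map_X, map_pow, map_natCast,
        C_pow]
    have hκ : φ (((q : ℚ) ^ (N * S))⁻¹) = ((q : ℝ) ^ (N * S))⁻¹ := by rw [map_inv₀, map_pow, map_natCast]
    simp only [Polynomial.map_mul, Polynomial.map_prod, Polynomial.map_C, hmapc]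
    rw [hκ]
    set RA : ℝ[X] := (reflectScale N ((q : ℚ) ^ d)⁻¹ A).map φ with hRA
    set RB : ℝ[X] := (reflectScale N ((q : ℚ) ^ d)⁻¹ B).map φ with hRB
    set Am : ℝ[X] := A.map φ with hAm
    set Bm : ℝ[X] := B.map φ with hBm
    -- the functional equation at `qʲT`
    have hj : ∀ j : ℕ,
        C (q : ℝ) ^ (j * (-χ).toNat) * X ^ (-χ).toNat * RA.comp (C (q : ℝ) ^ j * X) *
            Bm.comp (C (q : ℝ) ^ j * X) =
          C (((ε : ℤ) : ℝ) * (q : ℝ) ^ ((d : ℝ) * χ / 2)) * (C (q : ℝ) ^ (j * χ.toNat) * X ^ χ.toNat) *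
            Am.comp (C (q : ℝ) ^ j * X) * RB.comp (C (q : ℝ) ^ j * X) := by
      intro j
      have h := congrArg (fun P : ℝ[X] => P.comp (C (q : ℝ) ^ j * X)) hEq
      simp only [mul_comp, pow_comp, X_comp, C_comp, mul_pow, ← pow_mul] at h
      linear_combination h
    have hprod := Finset.prod_congr rfl fun i (_ : i ∈ s) => hj (a i)
    simp only [Finset.prod_mul_distrib, Finset.prod_pow_eq_pow_sum, ← Finset.sum_mul, Finset.prod_const,
      Finset.sum_const, smul_eq_mul] at hprod
    rw [← hS] at hprod
    set PRA : ℝ[X] := ∏ j ∈ s, RA.comp (C (q : ℝ) ^ a j * X) with hPRA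
    set PRB : ℝ[X] := ∏ j ∈ s, RB.comp (C (q : ℝ) ^ a j * X) with hPRB
    set PA : ℝ[X] := ∏ j ∈ s, Am.comp (C (q : ℝ) ^ a j * X) with hPA
    set PB : ℝ[X] := ∏ j ∈ s, Bm.comp (C (q : ℝ) ^ a j * X) with hPB
    -- the scalars: `q^{Sχ⁻} · ε^{#s} q^{(d+m)·#s·χ/2} = (ε q^{dχ/2})^{#s} · q^{Sχ⁺}`, by `2S = m·#s`
    have hε : ((((ε ^ s.card : ℤˣ)) : ℤ) : ℝ) = (((ε : ℤ) : ℝ)) ^ s.card := by norm_cast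
    have h1 : ((χ.toNat : ℕ) : ℝ) - (((-χ).toNat : ℕ) : ℝ) = (χ : ℝ) := by
      exact_mod_cast Int.toNat_sub_toNat_neg χ
    have h2 : (S : ℝ) * 2 = (m : ℝ) * (s.card : ℝ) := by
      have h := two_mul_sum_eq_of_symm hσs hσσ ha
      rw [← hS] at h
      have h' : ((2 * S : ℕ) : ℝ) = ((m * s.card : ℕ) : ℝ) := by rw [h]
      push_cast at h'
      linear_combination h'
    have hpow : (q : ℝ) ^ (S * (-χ).toNat) *
        (q : ℝ) ^ (((d + m : ℕ) : ℝ) * ((((s.card : ℕ) : ℤ) * χ : ℤ) : ℝ) / 2) =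
          ((q : ℝ) ^ ((d : ℝ) * χ / 2)) ^ s.card * (q : ℝ) ^ (S * χ.toNat) := by
      rw [← Real.rpow_natCast (q : ℝ) (S * (-χ).toNat), ← Real.rpow_natCast (q : ℝ) (S * χ.toNat),
        ← Real.rpow_mul_natCast hqR.le, ← Real.rpow_add hqR, ← Real.rpow_add hqR]
      congr 1
      push_cast
      linear_combination (-(S : ℝ)) * h1 + (-(χ : ℝ) / 2) * h2
    have hscal : (q : ℝ) ^ (S * (-χ).toNat) *
        (((((ε ^ s.card : ℤˣ)) : ℤ) : ℝ) * (q : ℝ) ^ (((d + m : ℕ) : ℝ) * ((((s.card : ℕ) : ℤ) * χ : ℤ) : ℝ) / 2)) =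
          ((((ε : ℤ) : ℝ)) * (q : ℝ) ^ ((d : ℝ) * χ / 2)) ^ s.card * (q : ℝ) ^ (S * χ.toNat) := by
      rw [hε, mul_pow, mul_left_comm, hpow]
      ring
    have hscalC : C (q : ℝ) ^ (S * (-χ).toNat) *
        C (((((ε ^ s.card : ℤˣ)) : ℤ) : ℝ) * (q : ℝ) ^ (((d + m : ℕ) : ℝ) * ((((s.card : ℕ) : ℤ) * χ : ℤ) : ℝ) / 2)) =
          C ((((ε : ℤ) : ℝ)) * (q : ℝ) ^ ((d : ℝ) * χ / 2)) ^ s.card * C (q : ℝ) ^ (S * χ.toNat) := by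
      rw [← C_pow, ← C_mul, hscal, C_mul, C_pow, C_pow]
    -- cancel the unit `C(q)^{Sχ⁻}` and combine
    have hu : IsUnit (C (q : ℝ) ^ (S * (-χ).toNat)) := (isUnit_C.mpr (IsUnit.mk0 _ hqR0)).pow _
    refine (IsUnit.mul_right_inj hu).mp ?_
    linear_combination (C (((q : ℝ) ^ (N * S))⁻¹)) * hprod -
      (X ^ (s.card * χ.toNat) * PA * (C (((q : ℝ) ^ (N * S))⁻¹) * PRB)) * hscalC

end Transfer

/-! ### §2 The functional equation of `Z(X × G(1, ℙⁿ⁺¹), T)` -/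

section Grassmannian

open PowerSeries (rescale)
open Finset

variable {k : Type u} [Field k] [Finite k] {X : SchemeOver k} {d : ℕ} {χ : ℤ}

/-- Membership in the set of Schubert symbols `{(a, b) : n ≥ a ≥ b ≥ 0}` (private plumbing). [folklore] -/
private theorem mem_schubertPairs_iff' {n : ℕ} (p : ℕ × ℕ) :
    p ∈ (range (n + 1) ×ˢ range (n + 1)).filter (fun p : ℕ × ℕ => p.2 ≤ p.1) ↔
      p.1 ∈ range (n + 1) ∧ p.2 ∈ range (p.1 + 1) := by
  simp only [mem_filter, mem_product, mem_range]
  omega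

/-- `Z(X × G(1, ℙⁿ⁺¹), T)` as ONE product over the Schubert symbols: `∏_{n ≥ a ≥ b ≥ 0} Z(X, q^{a+b}T)`.
[cite: Kahn2020, Prop. 2.3 (4), (5)] [cite: Weil1949, p. 508] -/
theorem zetaSeries_tensor_grassmannianOfLines_eq_prod_pairs (X : SchemeOver k) (n : ℕ) :
    zetaSeries (X ⊗ grassmannianOfLines (n + 1) k) =
      ∏ p ∈ (range (n + 1) ×ˢ range (n + 1)).filter (fun p : ℕ × ℕ => p.2 ≤ p.1),
        rescale ((Nat.card k : ℚ) ^ (p.1 + p.2)) (zetaSeries X) := by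
  rw [zetaSeries_tensor_grassmannianOfLines,
    prod_finset_product _ (range (n + 1)) (fun a => range (a + 1)) mem_schubertPairs_iff']

/-- **The functional equation of `Z(X × G(1, ℙⁿ⁺¹), T)` from that of `Z(X, T)`**: if `Z(X, T)` satisfies
`Z(1/(q^d T)) = ε q^{dχ/2} T^χ Z(T)` (`HasFunctionalEquation q d (Z X) χ`), then
`Z(X × G(1, ℙⁿ⁺¹), T) = ∏_{n ≥ a ≥ b ≥ 0} Z(X, q^{a+b}T)` satisfies the functional equation in dimension `d + 2n` with
`χ' = binom(n+2, 2)·χ = χ · E(G(1, ℙⁿ⁺¹))` and sign `ε^{binom(n+2,2)}` — the weights `a + b` being permuted by the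
complementary diagram `(a, b) ↦ (n−b, n−a)`, of constant sum `2n`. [cite: Hartshorne1977, App. C §1 (1.2) and Th. 4.4]
[cite: Kahn2020, Prop. 2.3 (4), (5); §3.3 p. 47] [cite: Weil1949, pp. 507–508] -/
theorem hasFunctionalEquation_tensor_grassmannianOfLines
    (hX : HasFunctionalEquation (Nat.card k) d (zetaSeries X) χ) (n : ℕ) :
    HasFunctionalEquation (Nat.card k) (d + 2 * n) (zetaSeries (X ⊗ grassmannianOfLines (n + 1) k))
      ((((n + 2).choose 2 : ℕ) : ℤ) * χ) := by
  rw [zetaSeries_tensor_grassmannianOfLines_eq_prod_pairs]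
  obtain ⟨h1, h2, h3⟩ := schubertPairs_compl n
  have h := hX.prod_rescale_of_symm (a := fun p : ℕ × ℕ => p.1 + p.2) (σ := fun p : ℕ × ℕ => (n - p.2, n - p.1))
    Nat.card_pos h1 h2 h3
  rwa [card_schubertPairs] at h

/-- The same for `G(1, ℙⁿ⁺¹) × X`. [cite: Hartshorne1977, App. C §1 (1.2) and Th. 4.4] [cite: Kahn2020, Prop. 2.3 (4), (5)] -/
theorem hasFunctionalEquation_grassmannianOfLines_tensor
    (hX : HasFunctionalEquation (Nat.card k) d (zetaSeries X) χ) (n : ℕ) :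
    HasFunctionalEquation (Nat.card k) (d + 2 * n) (zetaSeries (grassmannianOfLines (n + 1) k ⊗ X))
      ((((n + 2).choose 2 : ℕ) : ℤ) * χ) := by
  rw [zetaSeries_grassmannianOfLines_tensor_eq_prod_rescale, ← zetaSeries_tensor_grassmannianOfLines]
  exact hasFunctionalEquation_tensor_grassmannianOfLines hX n

/-- Example: **`ℙᵐ × G(1, ℙⁿ⁺¹)`** — dimension `m + 2n`, `E = binom(n+2, 2)·(m+1)` (from the tree's
`hasFunctionalEquation_projectiveSpace`, `E(ℙᵐ) = m + 1`). [cite: Hartshorne1977, App. C §1 (1.2) and Ex. 5.2] -/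
theorem hasFunctionalEquation_projectiveSpace_tensor_grassmannianOfLines (m n : ℕ) :
    HasFunctionalEquation (Nat.card k) (m + 2 * n) (zetaSeries (projectiveSpace m k ⊗ grassmannianOfLines (n + 1) k))
      ((((n + 2).choose 2 : ℕ) : ℤ) * ((m : ℤ) + 1)) :=
  hasFunctionalEquation_tensor_grassmannianOfLines hasFunctionalEquation_projectiveSpace n

/-- Example: **`G(1, ℙᵐ⁺¹) × G(1, ℙⁿ⁺¹)`** — dimension `2m + 2n`, `E = binom(n+2, 2)·binom(m+2, 2)` (from
`hasFunctionalEquation_grassmannianOfLines` of `TateTypeZetaFunctionalEquation`). [cite: Hartshorne1977, App. C §1 (1.2) and Th. 4.4]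
[cite: Weil1949, p. 508] -/
theorem hasFunctionalEquation_grassmannianOfLines_tensor_grassmannianOfLines (m n : ℕ) :
    HasFunctionalEquation (Nat.card k) (2 * m + 2 * n)
      (zetaSeries (grassmannianOfLines (m + 1) k ⊗ grassmannianOfLines (n + 1) k))
      ((((n + 2).choose 2 : ℕ) : ℤ) * (((m + 2).choose 2 : ℕ) : ℤ)) :=
  hasFunctionalEquation_tensor_grassmannianOfLines hasFunctionalEquation_grassmannianOfLines n

end Grassmannian

end Literature.AlgebraicGeometry.Motives

end
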